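import Literature.Computability.AlgebraicComplexity.SmallFormatMatMulRankCharTwo
import Literature.Computability.AlgebraicComplexity.GateQuotients
import HarnessLib

/-!
# ω-census family (a): Hensel-lift obstruction certificates — `𝔽₂` schemes that are the reduction of NO `ℤ/4ℤ` scheme

Cell `pub-omega` (HOME `run/shared/lean/pub/pub-omega/`, unit `pub-omega-tensor`, gen 2), topic
`Summits/MatrixMultiplication/OmegaCensus`.  Framing (verbatim): lottery ticket; floor = certified bounds/negative
ranges.  HONEST FRAMING: a kernel-checked CERTIFICATE CHECKER plus a precise negative result about explicit published
small-tensor objects; nothing here is progress on `ω`.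

## What is proved

Kauers–Moosbauer (ISSAC 2023, §5) report that none of their `> 100 000` rank-`47` schemes for `⟨4,4,4⟩` over `ℤ₂` — in
particular the one held in the tree as `SchemeMod2_444.c1/c2/c3` (`SmallFormatMatMulRankCharTwo.lean`) — "can be lifted
from `ℤ₂` to `ℤ₄`" (Hensel lifting, their §5), and likewise for their rank-`60` schemes for `⟨4,4,5⟩`; Perminov (2026) lists
`(4,4,4:47)`, `(4,4,5:60)`, `(4,5,5:73)` among the non-liftable `𝔽₂` schemes.  Those statements are outcomes of programs.
This file gives the statement a CHECKABLE form and a kernel proof for the tree-held objects: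

* "Lifts to `ℤ/4ℤ`" (the conclusion refuted by `HenselObstruction.not_lifts_of_certificate`, written out, no new
  definition): there are `w u v` over `ℤ/4ℤ`, `R` triads, reducing modulo `2` entrywise to the integer tables `(c1, c2, c3)`
  (slot conventions of `MatMulCellCheck`: slot 1 = output `(r,s)` flat `s + n·r`, slot 2 = `A`-position `(κ,μ)` flat
  `μ + m·κ`, slot 3 = `B`-position `(μ',ν)` flat `ν + n·μ'`), with `⟨k,m,n⟩ = ∑ₜ wₜ ⊗ uₜ ⊗ vₜ` over `ℤ/4ℤ`.
* `HenselObstruction.not_lifts_of_certificate` — SOUNDNESS of a Farkas-type certificate: a list `Y` of Brent-equation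
  indices `(r,s,κ,μ,μ',ν)` (nested pairs of naturals) with
  (C1) `∑_{e ∈ Y} (entryₑ(c) − rhsₑ) ≡ 2 (mod 4)` and (C2) for every variable (slot, term `t`, position) the sum over the
  equations of `Y` touching it of the product of the other two table entries is `≡ 0 (mod 2)`, refutes lifting to `ℤ/4ℤ`.
  Proof: write a lift as `w = c̄ + 2α` etc.; modulo `4`, `(c̄₁+2α)(c̄₂+2β)(c̄₃+2γ) = c̄₁c̄₂c̄₃ + 2(αc̄₂c̄₃ + c̄₁βc̄₃ + c̄₁c̄₂γ)`,
  so summing the Brent equations over `Y` gives `0 = 2 + 2·(even) = 2` in `ℤ/4ℤ`.  (This is the linear algebra of the first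
  Hensel step, `J(c̄)·Δ = (F(c̄) − rhs)/2` over `𝔽₂`, with `Y` a left-kernel vector of the Jacobian `J` pairing to `1` with the
  right-hand side; the certificates were found by Gaussian elimination over `𝔽₂` outside Lean and are merely CHECKED here.)
* Instances ((C1), (C2) and the range condition discharged by `decide +kernel` on the explicit certificate) are filed in
  the companion files `HenselLiftObstruction444.lean` (tree-held Kauers–Moosbauer `⟨4,4,4⟩:47` over `𝔽₂`, certificate of
  `379` of the `4096` equations), `HenselLiftObstruction445.lean` (`⟨4,4,5⟩:60`, `695` equations) and
  `HenselLiftObstruction455.lean` (Arai–Ichikawa–Hukushima `⟨4,5,5⟩:73`, `1324` equations): each such scheme is the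
  reduction of no `ℤ/4ℤ`-scheme with the same number of products (a fortiori of no integer or `2`-adically integral
  rational scheme).  This file declares no definitions (theorems only).

Census bookkeeping: second/third seats for these verdicts exist outside Lean (pub-omega ENG1 `eng1 lift` Farkas certificates,
referee `check_hensel_lift.py` Gaussian elimination, this seat's `farkas2.py`); the kernel is the tie-breaker.

## References

* M. Kauers, J. Moosbauer, *Flip graphs for matrix multiplication*, ISSAC 2023, arXiv:2212.01175, §5 (Hensel lifting;
  "none of our … schemes of rank 47 for (4,4,4) … can be lifted from ℤ₂ to ℤ₄"). [KauersMoosbauer2022FlipGraphs]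
* A. Fawzi et al., Nature 610 (2022), Suppl. Inf. §A.4 (no sign-lift of the rank-47 `ℤ₂` scheme with the same support —
  a weaker statement than non-liftability to `ℤ/4ℤ`). [FawziEtAl2022]
-/

namespace Summit.MatrixMultiplication.OmegaCensus

open scoped BigOperators
open Literature.Computability.AlgebraicComplexity
open Literature.Computability.AlgebraicComplexity.MatMulCellCheck

namespace HenselObstruction

variable (k m n R : ℕ) (c1 c2 c3 : List (List ℤ))

/-! ### Small algebraic facts in `ℤ/4ℤ` -/

/-- The kernel of `ℤ/4ℤ → ℤ/2ℤ` is `2·(ℤ/4ℤ)`. -/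
theorem exists_eq_add_two_mul (x y : ZMod 4)
    (h : ZMod.castHom (show 2 ∣ 4 by norm_num) (ZMod 2) x = ZMod.castHom (show 2 ∣ 4 by norm_num) (ZMod 2) y) :
    ∃ α : ZMod 4, x = y + 2 * α := by
  revert x y h; decide

/-- Product of three lifts modulo `4`. -/
theorem lift_mul3 (a b c x y z : ZMod 4) :
    (a + 2 * x) * (b + 2 * y) * (c + 2 * z) = a * b * c + 2 * (x * b * c + a * y * c + a * b * z) := by
  have h4 : (4 : ZMod 4) = 0 := by decide
  linear_combination (x * y * c + x * b * z + a * y * z + 2 * (x * y * z)) * h4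

/-- An integer `≡ 2 (mod 4)` is `2` in `ℤ/4ℤ`. -/
theorem intCast_eq_two_of_emod {S : ℤ} (h : S % 4 = 2) : (S : ZMod 4) = 2 := by
  have := ZMod.intCast_mod S 4
  rw [show ((4 : ℕ) : ℤ) = 4 from rfl, h] at this
  simpa using this.symm

/-- An integer `≡ 0 (mod 4)` is `0` in `ℤ/4ℤ`. -/
theorem intCast_eq_zero_of_emod {S : ℤ} (h : S % 4 = 0) : (S : ZMod 4) = 0 := by
  have := ZMod.intCast_mod S 4
  rw [show ((4 : ℕ) : ℤ) = 4 from rfl, h] at this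
  simpa using this.symm

/-! ### List-sum bookkeeping -/

/-- A list sum of zeros is zero. -/
theorem list_sum_map_eq_zero {α M : Type*} [AddCommMonoid M] (l : List α) (f : α → M) (h : ∀ a ∈ l, f a = 0) :
    (l.map f).sum = 0 := by
  induction l with
  | nil => simp
  | cons a l ih =>
    simp only [List.map_cons, List.sum_cons]
    rw [h a (by simp), ih (fun b hb => h b (by simp [hb])), add_zero]

/-- Congruence for `(l.map f).sum` under pointwise equality on `l`. -/
theorem list_sum_map_congr {α M : Type*} [AddCommMonoid M] (l : List α) (f g : α → M) (h : ∀ a ∈ l, f a = g a) :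
    (l.map f).sum = (l.map g).sum := by
  rw [List.map_congr_left h]

/-- Casting an integer list sum into `ℤ/4ℤ` termwise. -/
theorem intCast_list_sum_map {α : Type*} (l : List α) (f : α → ℤ) :
    (((l.map f).sum : ℤ) : ZMod 4) = (l.map fun a => ((f a : ℤ) : ZMod 4)).sum := by
  rw [Int.cast_list_sum, List.map_map]; rfl

/-! ### Soundness of the certificate -/

/-- **Soundness.** If the certificate `Y` is in range and passes (C1) and (C2), the `𝔽₂` scheme `(c1,c2,c3)` is the
reduction of no rank-`R` decomposition of `⟨k,m,n⟩` over `ℤ/4ℤ`. -/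
theorem not_lifts_of_certificate (Y : List (ℕ × ℕ × ℕ × ℕ × ℕ × ℕ))
    (hr : ∀ e ∈ Y, e.1 < k ∧ e.2.1 < n ∧ e.2.2.1 < k ∧ e.2.2.2.1 < m ∧ e.2.2.2.2.1 < m ∧ e.2.2.2.2.2 < n)
    (h1 : (Y.map fun e => entry m n R c1 c2 c3 e.1 e.2.1 e.2.2.1 e.2.2.2.1 e.2.2.2.2.1 e.2.2.2.2.2 -
      rhs 1 e.1 e.2.1 e.2.2.1 e.2.2.2.1 e.2.2.2.2.1 e.2.2.2.2.2).sum % 4 = 2)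
    (h2 : ∀ t < R,
      (∀ i < k, ∀ j < n, 2 * (Y.map fun e => if e.1 = i ∧ e.2.1 = j then
        tz c2 t (e.2.2.2.1 + m * e.2.2.1) * tz c3 t (e.2.2.2.2.2 + n * e.2.2.2.2.1) else 0).sum % 4 = 0) ∧
      (∀ i < k, ∀ j < m, 2 * (Y.map fun e => if e.2.2.1 = i ∧ e.2.2.2.1 = j then
        tz c1 t (e.2.1 + n * e.1) * tz c3 t (e.2.2.2.2.2 + n * e.2.2.2.2.1) else 0).sum % 4 = 0) ∧
      (∀ i < m, ∀ j < n, 2 * (Y.map fun e => if e.2.2.2.2.1 = i ∧ e.2.2.2.2.2 = j then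
        tz c1 t (e.2.1 + n * e.1) * tz c2 t (e.2.2.2.1 + m * e.2.2.1) else 0).sum % 4 = 0)) :
    ¬ ∃ (w : Fin R → Fin k × Fin n → ZMod 4) (u : Fin R → Fin k × Fin m → ZMod 4) (v : Fin R → Fin m × Fin n → ZMod 4),
      (∀ t a, ZMod.castHom (show 2 ∣ 4 by norm_num) (ZMod 2) (w t a) = ((tz c1 t.val (a.2.val + n * a.1.val) : ℤ) : ZMod 2)) ∧
      (∀ t b, ZMod.castHom (show 2 ∣ 4 by norm_num) (ZMod 2) (u t b) = ((tz c2 t.val (b.2.val + m * b.1.val) : ℤ) : ZMod 2)) ∧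
      (∀ t c, ZMod.castHom (show 2 ∣ 4 by norm_num) (ZMod 2) (v t c) = ((tz c3 t.val (c.2.val + n * c.1.val) : ℤ) : ZMod 2)) ∧
      matMulTensor (ZMod 4) k m n = ∑ t, triad (w t) (u t) (v t) := by
  rintro ⟨w, u, v, hw, hu, hv, hdec⟩
  -- total (ℕ-indexed) versions of the lift and of the tables, cast into `ℤ/4ℤ`
  let W : Fin R → ℕ → ℕ → ZMod 4 := fun t i j => if h : i < k ∧ j < n then w t (⟨i, h.1⟩, ⟨j, h.2⟩) else 0
  let U : Fin R → ℕ → ℕ → ZMod 4 := fun t i j => if h : i < k ∧ j < m then u t (⟨i, h.1⟩, ⟨j, h.2⟩) else 0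
  let V : Fin R → ℕ → ℕ → ZMod 4 := fun t i j => if h : i < m ∧ j < n then v t (⟨i, h.1⟩, ⟨j, h.2⟩) else 0
  let Wb : Fin R → ℕ → ℕ → ZMod 4 := fun t i j => ((tz c1 t.val (j + n * i) : ℤ) : ZMod 4)
  let Ub : Fin R → ℕ → ℕ → ZMod 4 := fun t i j => ((tz c2 t.val (j + m * i) : ℤ) : ZMod 4)
  let Vb : Fin R → ℕ → ℕ → ZMod 4 := fun t i j => ((tz c3 t.val (j + n * i) : ℤ) : ZMod 4)
  have castb : ∀ z : ℤ, ZMod.castHom (show 2 ∣ 4 by norm_num) (ZMod 2) ((z : ℤ) : ZMod 4) = ((z : ℤ) : ZMod 2) :=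
    fun z => map_intCast _ z
  -- lifts: W = Wb + 2α on in-range positions (α := 0 elsewhere, where we never look)
  have hα : ∀ t i j, ∃ α : ZMod 4, (i < k ∧ j < n) → W t i j = Wb t i j + 2 * α := by
    intro t i j
    by_cases h : i < k ∧ j < n
    · obtain ⟨α, hα⟩ := exists_eq_add_two_mul (W t i j) (Wb t i j) (by
        simp only [W, Wb, dif_pos h, castb]; exact hw t (⟨i, h.1⟩, ⟨j, h.2⟩))
      exact ⟨α, fun _ => hα⟩
    · exact ⟨0, fun h' => (h h').elim⟩
  have hβ : ∀ t i j, ∃ β : ZMod 4, (i < k ∧ j < m) → U t i j = Ub t i j + 2 * β := by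
    intro t i j
    by_cases h : i < k ∧ j < m
    · obtain ⟨β, hβ⟩ := exists_eq_add_two_mul (U t i j) (Ub t i j) (by
        simp only [U, Ub, dif_pos h, castb]; exact hu t (⟨i, h.1⟩, ⟨j, h.2⟩))
      exact ⟨β, fun _ => hβ⟩
    · exact ⟨0, fun h' => (h h').elim⟩
  have hγ : ∀ t i j, ∃ γ : ZMod 4, (i < m ∧ j < n) → V t i j = Vb t i j + 2 * γ := by
    intro t i j
    by_cases h : i < m ∧ j < n
    · obtain ⟨γ, hγ⟩ := exists_eq_add_two_mul (V t i j) (Vb t i j) (by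
        simp only [V, Vb, dif_pos h, castb]; exact hv t (⟨i, h.1⟩, ⟨j, h.2⟩))
      exact ⟨γ, fun _ => hγ⟩
    · exact ⟨0, fun h' => (h h').elim⟩
  choose α hα using hα
  choose β hβ using hβ
  choose γ hγ using hγ
  -- range facts for the equations of `Y`
  have hrng : ∀ e ∈ Y, e.1 < k ∧ e.2.1 < n ∧ e.2.2.1 < k ∧ e.2.2.2.1 < m ∧ e.2.2.2.2.1 < m ∧ e.2.2.2.2.2 < n := hr
  -- the Brent equation of the lift at an in-range index
  have brent : ∀ e ∈ Y, (∑ t : Fin R, W t e.1 e.2.1 * U t e.2.2.1 e.2.2.2.1 * V t e.2.2.2.2.1 e.2.2.2.2.2) =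
      ((rhs 1 e.1 e.2.1 e.2.2.1 e.2.2.2.1 e.2.2.2.2.1 e.2.2.2.2.2 : ℤ) : ZMod 4) := by
    intro e he
    obtain ⟨h1', h2', h3', h4', h5', h6'⟩ := hrng e he
    have hfun := congr_fun (congr_fun (congr_fun hdec (⟨e.1, h1'⟩, ⟨e.2.1, h2'⟩)) (⟨e.2.2.1, h3'⟩, ⟨e.2.2.2.1, h4'⟩)) (⟨e.2.2.2.2.1, h5'⟩, ⟨e.2.2.2.2.2, h6'⟩)
    rw [Finset.sum_apply, Finset.sum_apply, Finset.sum_apply] at hfun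
    simp only [triad_apply] at hfun
    have hl : (∑ t : Fin R, W t e.1 e.2.1 * U t e.2.2.1 e.2.2.2.1 * V t e.2.2.2.2.1 e.2.2.2.2.2) =
        ∑ t : Fin R, w t (⟨e.1, h1'⟩, ⟨e.2.1, h2'⟩) * u t (⟨e.2.2.1, h3'⟩, ⟨e.2.2.2.1, h4'⟩) * v t (⟨e.2.2.2.2.1, h5'⟩, ⟨e.2.2.2.2.2, h6'⟩) := by
      refine Finset.sum_congr rfl fun t _ => ?_
      simp only [W, U, V, dif_pos (And.intro h1' h2'), dif_pos (And.intro h3' h4'), dif_pos (And.intro h5' h6')]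
    rw [hl, ← hfun, rhs]
    unfold matMulTensor
    by_cases hc : e.1 = e.2.2.1 ∧ e.2.2.2.1 = e.2.2.2.2.1 ∧ e.2.1 = e.2.2.2.2.2
    · rw [if_pos hc, if_pos (by exact ⟨Fin.ext hc.1, Fin.ext hc.2.1, Fin.ext hc.2.2⟩)]; simp
    · rw [if_neg hc, if_neg (by
        rintro ⟨ha, hb, hc'⟩
        exact hc ⟨congrArg Fin.val ha, congrArg Fin.val hb, congrArg Fin.val hc'⟩)]
      simp
  -- expand each Brent equation of `Y` with the lifts
  have expand : ∀ e ∈ Y, (∑ t : Fin R, W t e.1 e.2.1 * U t e.2.2.1 e.2.2.2.1 * V t e.2.2.2.2.1 e.2.2.2.2.2) =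
      (∑ t : Fin R, Wb t e.1 e.2.1 * Ub t e.2.2.1 e.2.2.2.1 * Vb t e.2.2.2.2.1 e.2.2.2.2.2) +
      2 * ∑ t : Fin R, (α t e.1 e.2.1 * Ub t e.2.2.1 e.2.2.2.1 * Vb t e.2.2.2.2.1 e.2.2.2.2.2 + Wb t e.1 e.2.1 * β t e.2.2.1 e.2.2.2.1 * Vb t e.2.2.2.2.1 e.2.2.2.2.2 +
        Wb t e.1 e.2.1 * Ub t e.2.2.1 e.2.2.2.1 * γ t e.2.2.2.2.1 e.2.2.2.2.2) := by
    intro e he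
    obtain ⟨h1', h2', h3', h4', h5', h6'⟩ := hrng e he
    rw [Finset.mul_sum, ← Finset.sum_add_distrib]
    refine Finset.sum_congr rfl fun t _ => ?_
    rw [hα t e.1 e.2.1 ⟨h1', h2'⟩, hβ t e.2.2.1 e.2.2.2.1 ⟨h3', h4'⟩, hγ t e.2.2.2.2.1 e.2.2.2.2.2 ⟨h5', h6'⟩, lift_mul3]
  -- Part A: the table part is the integer of (C1), which is `2` in `ℤ/4ℤ`
  have partA : (Y.map fun e => (∑ t : Fin R, Wb t e.1 e.2.1 * Ub t e.2.2.1 e.2.2.2.1 * Vb t e.2.2.2.2.1 e.2.2.2.2.2) -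
      ((rhs 1 e.1 e.2.1 e.2.2.1 e.2.2.2.1 e.2.2.2.2.1 e.2.2.2.2.2 : ℤ) : ZMod 4)).sum = 2 := by
    have hc := intCast_eq_two_of_emod h1
    rw [intCast_list_sum_map] at hc
    rw [← hc]
    refine list_sum_map_congr _ _ _ fun e _ => ?_
    rw [Int.cast_sub, entry, List.sum_ofFn, Int.cast_sum]
    congr 1
    refine Finset.sum_congr rfl fun t _ => ?_
    simp only [Wb, Ub, Vb, Int.cast_mul]
  -- Part B: the correction terms vanish by (C2)
  have h2' : ∀ t : Fin R, (∀ i < k, ∀ j < n, (2 : ZMod 4) * (((Y.map fun e => if e.1 = i ∧ e.2.1 = j then tz c2 t.val (e.2.2.2.1 + m * e.2.2.1) * tz c3 t.val (e.2.2.2.2.2 + n * e.2.2.2.2.1) else 0).sum : ℤ) : ZMod 4) = 0) ∧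
      (∀ i < k, ∀ j < m, (2 : ZMod 4) * (((Y.map fun e => if e.2.2.1 = i ∧ e.2.2.2.1 = j then tz c1 t.val (e.2.1 + n * e.1) * tz c3 t.val (e.2.2.2.2.2 + n * e.2.2.2.2.1) else 0).sum : ℤ) : ZMod 4) = 0) ∧
      (∀ i < m, ∀ j < n, (2 : ZMod 4) * (((Y.map fun e => if e.2.2.2.2.1 = i ∧ e.2.2.2.2.2 = j then tz c1 t.val (e.2.1 + n * e.1) * tz c2 t.val (e.2.2.2.1 + m * e.2.2.1) else 0).sum : ℤ) : ZMod 4) = 0) := by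
    intro t
    obtain ⟨hA, hB, hC⟩ := h2 t.val t.isLt
    refine ⟨fun i hi j hj => ?_, fun i hi j hj => ?_, fun i hi j hj => ?_⟩
    · have := intCast_eq_zero_of_emod (hA i hi j hj); rwa [Int.cast_mul, Int.cast_ofNat] at this
    · have := intCast_eq_zero_of_emod (hB i hi j hj); rwa [Int.cast_mul, Int.cast_ofNat] at this
    · have := intCast_eq_zero_of_emod (hC i hi j hj); rwa [Int.cast_mul, Int.cast_ofNat] at this
  -- regrouping: Σ_{e∈Y} α(t, rₑ, sₑ)·Ubₜ(e)·Vbₜ(e) = Σ_{i<k} Σ_{j<n} α t i j · (slot-1 coefficient of (t,i,j))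
  have regroup1 : ∀ t : Fin R, (Y.map fun e => α t e.1 e.2.1 * Ub t e.2.2.1 e.2.2.2.1 * Vb t e.2.2.2.2.1 e.2.2.2.2.2).sum =
      ∑ i ∈ Finset.range k, ∑ j ∈ Finset.range n, α t i j * (((Y.map fun e => if e.1 = i ∧ e.2.1 = j then tz c2 t.val (e.2.2.2.1 + m * e.2.2.1) * tz c3 t.val (e.2.2.2.2.2 + n * e.2.2.2.2.1) else 0).sum : ℤ) : ZMod 4) := by
    intro t
    have step : (Y.map fun e => α t e.1 e.2.1 * Ub t e.2.2.1 e.2.2.2.1 * Vb t e.2.2.2.2.1 e.2.2.2.2.2).sum =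
        (Y.map fun e => ∑ i ∈ Finset.range k, ∑ j ∈ Finset.range n,
          (if e.1 = i ∧ e.2.1 = j then α t i j * (Ub t e.2.2.1 e.2.2.2.1 * Vb t e.2.2.2.2.1 e.2.2.2.2.2) else 0)).sum := by
      refine list_sum_map_congr _ _ _ fun e he => ?_
      obtain ⟨h1', h2', -, -, -, -⟩ := hrng e he
      rw [Finset.sum_eq_single_of_mem e.1 (Finset.mem_range.2 h1') (fun i _ hi => by
            rw [Finset.sum_eq_zero]; intro j _; rw [if_neg]; exact fun h => hi h.1.symm),
          Finset.sum_eq_single_of_mem e.2.1 (Finset.mem_range.2 h2') (fun j _ hj => by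
            rw [if_neg]; exact fun h => hj h.2.symm)]
      simp [mul_assoc]
    rw [step, DepthReduction.list_sum_finset_sum]
    refine Finset.sum_congr rfl fun i _ => ?_
    rw [DepthReduction.list_sum_finset_sum]
    refine Finset.sum_congr rfl fun j _ => ?_
    rw [intCast_list_sum_map, ← List.sum_map_mul_left]
    refine list_sum_map_congr _ _ _ fun e _ => ?_
    by_cases h : e.1 = i ∧ e.2.1 = j
    · simp only [if_pos h, Ub, Vb, Int.cast_mul]
    · simp only [if_neg h, Int.cast_zero, mul_zero]
  have regroup2 : ∀ t : Fin R, (Y.map fun e => Wb t e.1 e.2.1 * β t e.2.2.1 e.2.2.2.1 * Vb t e.2.2.2.2.1 e.2.2.2.2.2).sum =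
      ∑ i ∈ Finset.range k, ∑ j ∈ Finset.range m, β t i j * (((Y.map fun e => if e.2.2.1 = i ∧ e.2.2.2.1 = j then tz c1 t.val (e.2.1 + n * e.1) * tz c3 t.val (e.2.2.2.2.2 + n * e.2.2.2.2.1) else 0).sum : ℤ) : ZMod 4) := by
    intro t
    have step : (Y.map fun e => Wb t e.1 e.2.1 * β t e.2.2.1 e.2.2.2.1 * Vb t e.2.2.2.2.1 e.2.2.2.2.2).sum =
        (Y.map fun e => ∑ i ∈ Finset.range k, ∑ j ∈ Finset.range m,
          (if e.2.2.1 = i ∧ e.2.2.2.1 = j then β t i j * (Wb t e.1 e.2.1 * Vb t e.2.2.2.2.1 e.2.2.2.2.2) else 0)).sum := by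
      refine list_sum_map_congr _ _ _ fun e he => ?_
      obtain ⟨-, -, h3', h4', -, -⟩ := hrng e he
      rw [Finset.sum_eq_single_of_mem e.2.2.1 (Finset.mem_range.2 h3') (fun i _ hi => by
            rw [Finset.sum_eq_zero]; intro j _; rw [if_neg]; exact fun h => hi h.1.symm),
          Finset.sum_eq_single_of_mem e.2.2.2.1 (Finset.mem_range.2 h4') (fun j _ hj => by
            rw [if_neg]; exact fun h => hj h.2.symm)]
      simp only [and_self, if_true]; ring
    rw [step, DepthReduction.list_sum_finset_sum]
    refine Finset.sum_congr rfl fun i _ => ?_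
    rw [DepthReduction.list_sum_finset_sum]
    refine Finset.sum_congr rfl fun j _ => ?_
    rw [intCast_list_sum_map, ← List.sum_map_mul_left]
    refine list_sum_map_congr _ _ _ fun e _ => ?_
    by_cases h : e.2.2.1 = i ∧ e.2.2.2.1 = j
    · simp only [if_pos h, Wb, Vb, Int.cast_mul]
    · simp only [if_neg h, Int.cast_zero, mul_zero]
  have regroup3 : ∀ t : Fin R, (Y.map fun e => Wb t e.1 e.2.1 * Ub t e.2.2.1 e.2.2.2.1 * γ t e.2.2.2.2.1 e.2.2.2.2.2).sum =
      ∑ i ∈ Finset.range m, ∑ j ∈ Finset.range n, γ t i j * (((Y.map fun e => if e.2.2.2.2.1 = i ∧ e.2.2.2.2.2 = j then tz c1 t.val (e.2.1 + n * e.1) * tz c2 t.val (e.2.2.2.1 + m * e.2.2.1) else 0).sum : ℤ) : ZMod 4) := by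
    intro t
    have step : (Y.map fun e => Wb t e.1 e.2.1 * Ub t e.2.2.1 e.2.2.2.1 * γ t e.2.2.2.2.1 e.2.2.2.2.2).sum =
        (Y.map fun e => ∑ i ∈ Finset.range m, ∑ j ∈ Finset.range n,
          (if e.2.2.2.2.1 = i ∧ e.2.2.2.2.2 = j then γ t i j * (Wb t e.1 e.2.1 * Ub t e.2.2.1 e.2.2.2.1) else 0)).sum := by
      refine list_sum_map_congr _ _ _ fun e he => ?_
      obtain ⟨-, -, -, -, h5', h6'⟩ := hrng e he
      rw [Finset.sum_eq_single_of_mem e.2.2.2.2.1 (Finset.mem_range.2 h5') (fun i _ hi => by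
            rw [Finset.sum_eq_zero]; intro j _; rw [if_neg]; exact fun h => hi h.1.symm),
          Finset.sum_eq_single_of_mem e.2.2.2.2.2 (Finset.mem_range.2 h6') (fun j _ hj => by
            rw [if_neg]; exact fun h => hj h.2.symm)]
      simp only [and_self, if_true]; ring
    rw [step, DepthReduction.list_sum_finset_sum]
    refine Finset.sum_congr rfl fun i _ => ?_
    rw [DepthReduction.list_sum_finset_sum]
    refine Finset.sum_congr rfl fun j _ => ?_
    rw [intCast_list_sum_map, ← List.sum_map_mul_left]
    refine list_sum_map_congr _ _ _ fun e _ => ?_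
    by_cases h : e.2.2.2.2.1 = i ∧ e.2.2.2.2.2 = j
    · simp only [if_pos h, Wb, Ub, Int.cast_mul]
    · simp only [if_neg h, Int.cast_zero, mul_zero]
  have partB : ∀ t : Fin R, (2 : ZMod 4) * (Y.map fun e => (α t e.1 e.2.1 * Ub t e.2.2.1 e.2.2.2.1 * Vb t e.2.2.2.2.1 e.2.2.2.2.2 +
      Wb t e.1 e.2.1 * β t e.2.2.1 e.2.2.2.1 * Vb t e.2.2.2.2.1 e.2.2.2.2.2 + Wb t e.1 e.2.1 * Ub t e.2.2.1 e.2.2.2.1 * γ t e.2.2.2.2.1 e.2.2.2.2.2)).sum = 0 := by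
    intro t
    obtain ⟨hA, hB, hC⟩ := h2' t
    rw [List.sum_map_add, List.sum_map_add, regroup1, regroup2, regroup3, mul_add, mul_add,
      Finset.mul_sum, Finset.mul_sum, Finset.mul_sum]
    have e1 : ∑ i ∈ Finset.range k, 2 * ∑ j ∈ Finset.range n, α t i j * (((Y.map fun e => if e.1 = i ∧ e.2.1 = j then tz c2 t.val (e.2.2.2.1 + m * e.2.2.1) * tz c3 t.val (e.2.2.2.2.2 + n * e.2.2.2.2.1) else 0).sum : ℤ) : ZMod 4) = 0 := by
      refine Finset.sum_eq_zero fun i hi => ?_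
      rw [Finset.mul_sum]; refine Finset.sum_eq_zero fun j hj => ?_
      rw [mul_left_comm, hA i (Finset.mem_range.1 hi) j (Finset.mem_range.1 hj), mul_zero]
    have e2 : ∑ i ∈ Finset.range k, 2 * ∑ j ∈ Finset.range m, β t i j * (((Y.map fun e => if e.2.2.1 = i ∧ e.2.2.2.1 = j then tz c1 t.val (e.2.1 + n * e.1) * tz c3 t.val (e.2.2.2.2.2 + n * e.2.2.2.2.1) else 0).sum : ℤ) : ZMod 4) = 0 := by
      refine Finset.sum_eq_zero fun i hi => ?_
      rw [Finset.mul_sum]; refine Finset.sum_eq_zero fun j hj => ?_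
      rw [mul_left_comm, hB i (Finset.mem_range.1 hi) j (Finset.mem_range.1 hj), mul_zero]
    have e3 : ∑ i ∈ Finset.range m, 2 * ∑ j ∈ Finset.range n, γ t i j * (((Y.map fun e => if e.2.2.2.2.1 = i ∧ e.2.2.2.2.2 = j then tz c1 t.val (e.2.1 + n * e.1) * tz c2 t.val (e.2.2.2.1 + m * e.2.2.1) else 0).sum : ℤ) : ZMod 4) = 0 := by
      refine Finset.sum_eq_zero fun i hi => ?_
      rw [Finset.mul_sum]; refine Finset.sum_eq_zero fun j hj => ?_
      rw [mul_left_comm, hC i (Finset.mem_range.1 hi) j (Finset.mem_range.1 hj), mul_zero]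
    rw [e1, e2, e3]; simp
  -- assemble: 0 = Σ_{e∈Y} (Brentₑ − rhsₑ) = 2 + 0
  have total : (Y.map fun e => (∑ t : Fin R, W t e.1 e.2.1 * U t e.2.2.1 e.2.2.2.1 * V t e.2.2.2.2.1 e.2.2.2.2.2) -
      ((rhs 1 e.1 e.2.1 e.2.2.1 e.2.2.2.1 e.2.2.2.2.1 e.2.2.2.2.2 : ℤ) : ZMod 4)).sum = 0 :=
    list_sum_map_eq_zero _ _ fun e he => by rw [brent e he, sub_self]
  have total' : (Y.map fun e => (∑ t : Fin R, W t e.1 e.2.1 * U t e.2.2.1 e.2.2.2.1 * V t e.2.2.2.2.1 e.2.2.2.2.2) -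
      ((rhs 1 e.1 e.2.1 e.2.2.1 e.2.2.2.1 e.2.2.2.2.1 e.2.2.2.2.2 : ℤ) : ZMod 4)).sum =
      (Y.map fun e => (∑ t : Fin R, Wb t e.1 e.2.1 * Ub t e.2.2.1 e.2.2.2.1 * Vb t e.2.2.2.2.1 e.2.2.2.2.2) -
        ((rhs 1 e.1 e.2.1 e.2.2.1 e.2.2.2.1 e.2.2.2.2.1 e.2.2.2.2.2 : ℤ) : ZMod 4)).sum +
      (Y.map fun e => 2 * ∑ t : Fin R, (α t e.1 e.2.1 * Ub t e.2.2.1 e.2.2.2.1 * Vb t e.2.2.2.2.1 e.2.2.2.2.2 +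
        Wb t e.1 e.2.1 * β t e.2.2.1 e.2.2.2.1 * Vb t e.2.2.2.2.1 e.2.2.2.2.2 + Wb t e.1 e.2.1 * Ub t e.2.2.1 e.2.2.2.1 * γ t e.2.2.2.2.1 e.2.2.2.2.2)).sum := by
    rw [← List.sum_map_add]
    refine list_sum_map_congr _ _ _ fun e he => ?_
    rw [expand e he]; ring
  have corr : (Y.map fun e => 2 * ∑ t : Fin R, (α t e.1 e.2.1 * Ub t e.2.2.1 e.2.2.2.1 * Vb t e.2.2.2.2.1 e.2.2.2.2.2 +
      Wb t e.1 e.2.1 * β t e.2.2.1 e.2.2.2.1 * Vb t e.2.2.2.2.1 e.2.2.2.2.2 + Wb t e.1 e.2.1 * Ub t e.2.2.1 e.2.2.2.1 * γ t e.2.2.2.2.1 e.2.2.2.2.2)).sum = 0 := by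
    rw [List.sum_map_mul_left, DepthReduction.list_sum_finset_sum, Finset.mul_sum]
    exact Finset.sum_eq_zero fun t _ => partB t
  rw [total', partA, corr, add_zero] at total
  exact absurd total (by decide)

end HenselObstruction

end Summit.MatrixMultiplication.OmegaCensus
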